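import Summits.HodgeConjecture.HodgeConjecture.Theorems.SecondaryPeriodsConiveauOneFailureEllipticRealisation

/-!
# Route `SecondaryPeriods`, crux `ConiveauOneFailure` (stmt-HodgeConjecture-3540): the level-one
# reduction with a CLASS OF CURVES threaded, and the rank-two attractor plane realised by a
# one-dimensional abelian variety

Sequel of `Theorems/SecondaryPeriodsConiveauOneFailureEllipticRealisation` (rank-two Riemann with the
elliptic curve remembered as a bundled `Motives.AbelianVariety ℂ`). The tree's rank-local reduction
`levelOne_subHodge_eq_range_of_curve_of_weightOneOfRank` (Voisin I §7.3.1, Abdulali Prop. 3.2: a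
rationally spanned level-one sub-Hodge structure `W ⊆ H^{2s+1}(Y(ℂ); ℂ)` is `φ(H¹(C(ℂ)))` for a
curve `C` supplied by Riemann's theorem in the rank of `W`) hides the curve behind an existential.
Here the same proof is run with an arbitrary class of curves `P` carried along, so that consumers
learn that the realising curve lies in `P`:

* `levelOne_subHodge_eq_range_of_curve_of_weightOneOfRank_mem` — the reduction with `P` threaded
  (proof verbatim; `P` is carried, not used);
* `exists_abelianCurve_of_levelOne_threefold_span_of_finrank_eq_two` — **a rank-two rational
  level-one sub-Hodge plane of `H³` of a smooth projective threefold is `φ(H¹(E(ℂ)))` for a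
  ONE-DIMENSIONAL COMPLEX ABELIAN VARIETY `E` and a rational type-`(1,1)` map `φ`** (binder shape of
  the route items) — the input of the abelian no-go for the heart of the crux
  (`Theorems/SecondaryPeriodsConiveauOneFailureAbelianNoGo`).

Everything is proved (axioms `propext`, `Classical.choice`, `Quot.sound`); no definition, no named
fact. TODO(general form): the threaded reduction is a pure strengthening of the statement in
`Literature/AlgebraicGeometry/HodgeTheory/LevelOneSubHodgeStructuresOfCurvesRankTwo` and belongs there.

## References

* [VoisinHodgeI2002] C. Voisin, Hodge Theory and Complex Algebraic Geometry I, CUP 2002, §7.2.2,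
  §7.3.1 (Def. 7.22, Lemma 7.26).
* [KerrPearlstein2016] M. Kerr, G. Pearlstein (eds.), Recent Advances in Hodge Theory, CUP 2016,
  Ch. 11 (S. Abdulali), §1 p. 288 and Prop. 3.2 p. 291.
* [SilvermanAEC2009] J. H. Silverman, The Arithmetic of Elliptic Curves, III.3.6, VI Prop. 3.6 (b).
-/

noncomputable section

-- every declaration of this problem lives in `Summit.HodgeConjecture.HodgeConjecture.…` (summit = sub-problem), which `linter.dupNamespace` flags
set_option linter.dupNamespace false

namespace Summit.HodgeConjecture.HodgeConjecture.Theorems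

open scoped TensorProduct
open CategoryTheory AlgebraicGeometry
open Literature.AlgebraicTopology.SingularHomology
open Literature.AlgebraicGeometry Literature.AlgebraicGeometry.HodgeTheory
open Literature.AlgebraicGeometry.Motives (HodgeStructure SchemeOver IsSmoothProjective ComplexPoints
  AbelianVariety)
open Literature.AlgebraicGeometry.Motives.HodgeStructure

/-! ### The rank-local reduction with a class of curves threaded -/

/-- **`levelOne_subHodge_eq_range_of_curve_of_weightOneOfRank` with a class of curves `P`
threaded.** Given `W ⊆ H^{2s+1}(Y(ℂ); ℂ)` rationally spanned, stable under the type decomposition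
and of Hodge coniveau `≥ s`, and granted Riemann's theorem in the curve form for the polarisable
effective weight-one `ℚ`-Hodge structures of dimension `dim_ℂ W` WITH CURVES IN THE CLASS `P`:
`W = φ(H¹(C(ℂ); ℂ))` for a smooth projective curve `C` IN `P`, a Hodge model `B` and a rational map
`φ` of type `(s, s)`. The proof is that of the tree's reduction verbatim (real model `A'`; rational
form `K` of `W`, `K ⊗ ℂ ≅ W`; the sub-Hodge structure `S` it underlies; the twist `S(s)` is
polarisable — `smoothProjective_hodgeStructure_isPolarizable_holds` — and effective —
`HodgeModel.disjoint_hodgePQ_hodgeConiveau`; Riemann gives `f : H¹(C(ℂ); ℚ) ↠ K`;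
`φ = β_Y ∘ (ι_K ∘ f) ⊗ ℂ ∘ β_C⁻¹`); the class `P` is carried along, not used.
[cite: VoisinHodgeI2002, §7.2.2, §7.3.1 Def. 7.22 and Lemma 7.26]
[cite: KerrPearlstein2016, Ch. 11 (Abdulali) §1 p. 288] -/
theorem levelOne_subHodge_eq_range_of_curve_of_weightOneOfRank_mem (P : SchemeOver ℂ → Prop)
    ⦃n : ℕ⦄ ⦃Y : SchemeOver ℂ⦄ (hY : IsSmoothProjective n Y) (A : HodgeModel n Y) (s : ℕ)
    (W : Submodule ℂ (complexBetti Y (2 * s + 1))) (hW : IsRationallySpanned W)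
    (hsub : W.map (A.pullback (2 * s + 1)).hom =
      ⨆ (p : ℕ) (q : ℕ) (_ : p + q = 2 * s + 1),
        W.map (A.pullback (2 * s + 1)).hom ⊓ A.hodgePQ (2 * s + 1) p q)
    (hlev : W.map (A.pullback (2 * s + 1)).hom ≤ A.hodgeConiveau (2 * s + 1) s)
    (h0 : ∀ ⦃V : Type⦄ [AddCommGroup V] [Module ℚ V] [Module.Finite ℚ V],
      Module.finrank ℚ V = Module.finrank ℂ W → ∀ (H : HodgeStructure V 1),
      H.IsPolarizable → (∀ p q : ℤ, H.piece p q ≠ ⊥ → 0 ≤ p ∧ 0 ≤ q) →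
      ∃ (C : SchemeOver ℂ), P C ∧ ∃ (hC : IsSmoothProjective 1 C) (B : HodgeModel 1 C)
        (hB : B.IsHodgeSymmetric)
        (f : HodgeStructure.Hom ((B.hodgeStructure hC hB 1).cast Nat.cast_one) H),
        Function.Surjective f.toLinearMap) :
    ∃ (C : SchemeOver ℂ), P C ∧ ∃ (_ : IsSmoothProjective 1 C) (B : HodgeModel 1 C)
      (φ : complexBetti C 1 →ₗ[ℂ] complexBetti Y (2 * s + 1)),
      (∀ c, IsRationalClass c → IsRationalClass (φ c)) ∧
      (∀ (p q : ℕ), p + q = 1 → ∀ c, B.pullback 1 c ∈ B.hodgePQ 1 p q →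
        A.pullback (2 * s + 1) (φ c) ∈ A.hodgePQ (2 * s + 1) (p + s) (q + s)) ∧
      LinearMap.range φ = W := by
  classical
  have hpol : smoothProjective_hodgeStructure_isPolarizable :=
    smoothProjective_hodgeStructure_isPolarizable_holds
  -- 1. a real (Hodge symmetric) model `A'`, in which we read everything
  obtain ⟨A', hA'real⟩ := exists_isReal_hodgeModel_holds n Y hY
  have hA' : A'.IsHodgeSymmetric := hA'real.isHodgeSymmetric
  have hsub' := map_pullback_eq_iSup_of_hodgeModel hY A A' hsub
  have hlev' := map_pullback_le_hodgeConiveau_of_hodgeModel hY A A' hlev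
  -- 2. the rational form `K` of `W`
  set β := ofRatClassBaseChangeEquiv hY (2 * s + 1) with hβ
  set Wc : Submodule ℂ (ℂ ⊗[ℚ] Motives.bettiCohomology Y (2 * s + 1)) := W.comap β.toLinearMap
    with hWc
  set K : Submodule ℚ (Motives.bettiCohomology Y (2 * s + 1)) :=
    (Wc.restrictScalars ℚ).comap Motives.HodgeStructure.ofRat with hK
  have hKW : ∀ v, v ∈ K ↔ ofRatClass (Motives.ComplexPoints Y) (2 * s + 1) v ∈ W := by
    intro v
    change β (Motives.HodgeStructure.ofRat v) ∈ W ↔ _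
    rw [ofRatClassBaseChangeEquiv_apply, ofRatClassBaseChange_ofRat]
  -- 3. `K ⊗ ℂ = β⁻¹ W` (`W` is rationally spanned)
  have hbc : K.baseChange ℂ = Wc := by
    apply le_antisymm
    · rw [Submodule.baseChange_eq_span]
      refine Submodule.span_le.2 ?_
      rintro _ ⟨v, hv, rfl⟩
      exact hv
    · intro x hx
      have hxW : β x ∈ Submodule.span ℂ {c | c ∈ W ∧ IsRationalClass c} := by
        rw [← hW]; exact hx
      have hspan : Submodule.span ℂ {c | c ∈ W ∧ IsRationalClass c} ≤
          (K.baseChange ℂ).map β.toLinearMap := by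
        refine Submodule.span_le.2 ?_
        rintro c ⟨hcW, hcrat⟩
        obtain ⟨v, rfl⟩ := (isRationalClass_iff_mem_range_ofRatClass c).1 hcrat
        refine ⟨Motives.HodgeStructure.ofRat v, ?_, ?_⟩
        · exact Submodule.tmul_mem_baseChange_of_mem 1 ((hKW v).2 hcW)
        · change β _ = _
          rw [ofRatClassBaseChangeEquiv_apply, ofRatClassBaseChange_ofRat]
      obtain ⟨y, hy, hyx⟩ := hspan hxW
      have hyx' : y = x := β.injective hyx
      rwa [← hyx']
  have hWK : W = (K.baseChange ℂ).map β.toLinearMap := by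
    rw [hbc, hWc, Submodule.map_comap_eq_of_surjective β.surjective]
  -- 4. `K` underlies a sub-Hodge structure `S` of `H^{2s+1}(Y(ℂ); ℚ)`
  have hdec := A'.baseChange_eq_iSup_of_map_pullback hY (2 * s + 1) K (by
    have hmap : (K.baseChange ℂ).map (Motives.ofRatClassBaseChange (Motives.ComplexPoints Y) (2 * s + 1)) = W := by
      rw [hWK]; rfl
    rw [hmap]; exact hsub')
  obtain ⟨S, hS⟩ := A'.exists_subHodgeStructure_of_decomposition hY hA' (2 * s + 1) K hdec
  -- finite-dimensionality
  letI := hY.chartedSpace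
  haveI := Motives.ComplexPoints.compactSpace_of_isSmoothProjective hY
  haveI := Motives.ComplexPoints.t2Space_of_isSmoothProjective hY
  haveI : Module.Finite ℚ (Motives.bettiCohomology Y (2 * s + 1)) :=
    finite_singularCohomology_of_compact_chartedSpace ℚ ℚ (d := 2 * n) (2 * s + 1)
  -- 5. the twisted structure `T = S(s)` of weight `1`
  have h1 : ((2 * s + 1 : ℕ) : ℤ) - 2 * (s : ℤ) = 1 := by push_cast; ring
  set T : HodgeStructure S.toSubmodule 1 := (S.toHodgeStructure.tateTwist s).cast h1 with hT
  -- 6. `T` is polarisable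
  have hTpol : T.IsPolarizable :=
    ((HodgeStructure.SubHodgeStructure.isPolarizable (hpol hY A' hA' (2 * s + 1)) S).tateTwist (s : ℤ)).cast h1
  -- 7. `T` is effective: its non-zero pieces are `(1,0)` and `(0,1)`
  have hinjS : Function.Injective (S.toSubmodule.subtype.baseChange ℂ) :=
    Motives.HodgeStructure.baseChange_injective_of_injective S.toSubmodule.injective_subtype
  -- membership of the images of `K ⊗ ℂ` in `W`
  have hmemW : ∀ x : ℂ ⊗[ℚ] S.toSubmodule,
      β (S.toSubmodule.subtype.baseChange ℂ x) ∈ W := by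
    intro x
    have hx : S.toSubmodule.subtype.baseChange ℂ x ∈
        (LinearMap.range S.toSubmodule.subtype).baseChange ℂ := by
      rw [← Motives.HodgeStructure.range_baseChange]
      exact LinearMap.mem_range_self _ x
    have hSK : S.toSubmodule.baseChange ℂ = Wc := by rw [hS]; exact hbc
    rw [Submodule.range_subtype, hSK] at hx
    exact hx
  -- a non-zero element of the piece `(P, Q)` of `H_Y` lying over `W` forces `s ≤ P` and `s ≤ Q`
  have hkey : ∀ (P' Q' : ℤ) (y : ℂ ⊗[ℚ] Motives.bettiCohomology Y (2 * s + 1)),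
      y ∈ (A'.hodgeStructure hY hA' (2 * s + 1)).piece P' Q' → β y ∈ W → y ≠ 0 →
      (s : ℤ) ≤ P' ∧ (s : ℤ) ≤ Q' := by
    intro P' Q' y hy hyW hy0
    -- `P' + Q' = 2s + 1`, `0 ≤ P' ≤ 2s + 1`
    have hPQ : P' + Q' = ((2 * s + 1 : ℕ) : ℤ) := by
      by_contra h
      rw [HodgeStructure.piece_eq_bot_of_add_ne _ h, Submodule.mem_bot] at hy
      exact hy0 hy
    have hP0 : 0 ≤ P' := by
      by_contra h
      push Not at h
      rw [HodgeStructure.mem_piece_iff _ hPQ, HodgeModel.hodgeStructure_F, HodgeModel.hodgeStructure_F,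
        A'.ratF_eq_bot hY (2 * s + 1) (show ((2 * s + 1 : ℕ) : ℤ) < Q' by omega),
        Submodule.mem_bot] at hy
      apply hy0
      have hc : Motives.HodgeStructure.conj y = 0 := hy.2
      have := congrArg Motives.HodgeStructure.conj hc
      rwa [Motives.HodgeStructure.conj_conj, map_zero] at this
    have hQ0 : 0 ≤ Q' := by
      by_contra h
      push Not at h
      rw [HodgeStructure.mem_piece_iff _ hPQ, HodgeModel.hodgeStructure_F,
        A'.ratF_eq_bot hY (2 * s + 1) (show ((2 * s + 1 : ℕ) : ℤ) < P' by omega),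
        Submodule.mem_bot] at hy
      exact hy0 hy.1
    -- read the piece in the model: `A'^*(β y) ∈ H^{p',q'}`, `p' = P'`, `q' = Q'`
    obtain ⟨p', hp'⟩ : ∃ p' : ℕ, (p' : ℤ) = P' := ⟨P'.toNat, Int.toNat_of_nonneg hP0⟩
    obtain ⟨q', hq'⟩ : ∃ q' : ℕ, (q' : ℤ) = Q' := ⟨Q'.toNat, Int.toNat_of_nonneg hQ0⟩
    have hpq' : p' + q' = 2 * s + 1 := by omega
    subst hp' hq'
    rw [A'.piece_eq_ratPiece hY hA' hpq', HodgeModel.mem_ratPiece_iff, HodgeModel.complexification_apply] at hy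
    have hyc : (A'.pullback (2 * s + 1)).hom (β y) ∈ A'.hodgeConiveau (2 * s + 1) s :=
      hlev' (Submodule.mem_map_of_mem hyW)
    by_contra hlt
    rw [not_and_or, not_le, not_le] at hlt
    have hdis := A'.disjoint_hodgePQ_hodgeConiveau hpq' (s := s) (by omega)
    have h0' : (A'.pullback (2 * s + 1)).hom (β y) = 0 :=
      (Submodule.disjoint_def.1 hdis) _ hy hyc
    apply hy0
    apply β.injective
    rw [map_zero]
    exact A'.pullback_injective (2 * s + 1) (by rw [map_zero]; exact h0')
  have heff : ∀ p q : ℤ, T.piece p q ≠ ⊥ → 0 ≤ p ∧ 0 ≤ q := by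
    intro p q hne
    obtain ⟨x, hx, hx0⟩ := (Submodule.ne_bot_iff _).1 hne
    rw [hT, Motives.HodgeStructure.cast_piece, Motives.piece_tateTwist,
      Motives.HodgeStructure.SubHodgeStructure.mem_piece_iff] at hx
    have hy0 : S.toSubmodule.subtype.baseChange ℂ x ≠ 0 := fun h ↦ hx0 (hinjS (by rw [h, map_zero]))
    obtain ⟨h1', h2'⟩ := hkey _ _ _ hx (hmemW x) hy0
    constructor <;> omega
  -- 8. the rank count `dim_ℚ K = dim_ℂ (K ⊗ ℂ) = dim_ℂ W`, and the curve (in the class `P`)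
  have hrank : Module.finrank ℚ S.toSubmodule = Module.finrank ℂ W := by
    have hr1 : Module.finrank ℂ (LinearMap.range (S.toSubmodule.subtype.baseChange ℂ)) =
        Module.finrank ℂ (ℂ ⊗[ℚ] S.toSubmodule) :=
      LinearMap.finrank_range_of_inj hinjS
    have hr2 : LinearMap.range (S.toSubmodule.subtype.baseChange ℂ) = Wc := by
      rw [Motives.HodgeStructure.range_baseChange, Submodule.range_subtype, hS]
      exact hbc
    have hr3 : Module.finrank ℂ Wc = Module.finrank ℂ W := by
      rw [hWc, Submodule.comap_equiv_eq_map_symm]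
      exact LinearEquiv.finrank_map_eq β.symm W
    rw [← hr3, ← hr2, hr1, Module.finrank_baseChange]
  obtain ⟨C, hPC, hC, B, hB, f, hf⟩ := h0 hrank T hTpol heff
  -- 9. the map `φ = β_Y ∘ ((ι_K ∘ f) ⊗ ℂ) ∘ β_C⁻¹`
  set φq : Motives.bettiCohomology C 1 →ₗ[ℚ] Motives.bettiCohomology Y (2 * s + 1) :=
    S.toSubmodule.subtype ∘ₗ f.toLinearMap with hφq
  set βC := ofRatClassBaseChangeEquiv hC 1 with hβC
  set φ : complexBetti C 1 →ₗ[ℂ] complexBetti Y (2 * s + 1) :=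
    β.toLinearMap ∘ₗ (φq.baseChange ℂ) ∘ₗ βC.symm.toLinearMap with hφ
  have hφapply : ∀ c, φ c = β (φq.baseChange ℂ (βC.symm c)) := fun c ↦ rfl
  refine ⟨C, hPC, hC, B, φ, ?_, ?_, ?_⟩
  · -- rational classes go to rational classes
    intro c hc
    obtain ⟨v, rfl⟩ := (isRationalClass_iff_mem_range_ofRatClass c).1 hc
    rw [hφapply, hβC, ofRatClassBaseChangeEquiv_symm_ofRatClass, Motives.HodgeStructure.baseChange_ofRat,
      hβ, ofRatClassBaseChangeEquiv_apply, ofRatClassBaseChange_ofRat]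
    exact (isRationalClass_iff_mem_range_ofRatClass _).2 ⟨_, rfl⟩
  · -- types `(p, q) ↦ (p + s, q + s)`
    intro p q hpq c hc
    -- `β_C⁻¹ c` lies in the piece `(p, q)` of `H¹(C)`
    have hx : βC.symm c ∈ ((B.hodgeStructure hC hB 1).cast Nat.cast_one).piece p q := by
      rw [Motives.HodgeStructure.cast_piece, B.piece_eq_ratPiece hC hB hpq, HodgeModel.mem_ratPiece_iff,
        HodgeModel.complexification_apply]
      have : Motives.ofRatClassBaseChange (Motives.ComplexPoints C) 1 (βC.symm c) = c := by
        rw [← ofRatClassBaseChangeEquiv_apply hC 1, hβC, LinearEquiv.apply_symm_apply]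
      rw [this]
      exact hc
    -- `f` maps it into the piece `(p, q)` of `T = S(s)`, i.e. the piece `(p + s, q + s)` of `S`
    have hfx : f.toLinearMap.baseChange ℂ (βC.symm c) ∈ T.piece p q :=
      f.map_piece_le p q ⟨_, hx, rfl⟩
    have hTpiece : T.piece p q = S.toHodgeStructure.piece (p + s) (q + s) := by
      rw [hT, Motives.HodgeStructure.cast_piece, Motives.piece_tateTwist]
    rw [hTpiece, Motives.HodgeStructure.SubHodgeStructure.mem_piece_iff] at hfx
    -- read in the model `A'`: the image lies in `Θ_{A'}⁻¹(H^{p+s,q+s})`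
    have hps : ((p : ℤ) + s) = ((p + s : ℕ) : ℤ) := by push_cast; ring
    have hqs : ((q : ℤ) + s) = ((q + s : ℕ) : ℤ) := by push_cast; ring
    rw [hps, hqs, A'.piece_eq_ratPiece hY hA' (show (p + s) + (q + s) = 2 * s + 1 by omega),
      HodgeModel.mem_ratPiece_iff, HodgeModel.complexification_apply] at hfx
    have hcomp : S.toSubmodule.subtype.baseChange ℂ (f.toLinearMap.baseChange ℂ (βC.symm c)) =
        φq.baseChange ℂ (βC.symm c) := by
      rw [hφq, LinearMap.baseChange_comp, LinearMap.comp_apply]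
    rw [hcomp] at hfx
    -- so `A'^*(φ c) ∈ H^{p+s,q+s}`; transfer to `A`
    refine HodgeModel.pullback_mem_hodgePQ_of_hodgeModel hY A' A ?_
    rw [hφapply, hβ, ofRatClassBaseChangeEquiv_apply]
    exact hfx
  · -- `im φ = W`
    rw [hφ, LinearMap.range_comp, LinearMap.range_comp, LinearEquiv.range, Submodule.map_top,
      Motives.HodgeStructure.range_baseChange, hφq,
      LinearMap.range_comp_of_range_eq_top _ (LinearMap.range_eq_top.2 hf), Submodule.range_subtype, hS,
      ← hWK]

/-! ### The threefold binder shape, rank two: the plane is `φ(H¹(E(ℂ)))`, `E` an abelian variety of dimension one -/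

/-- **A rank-two rational level-one sub-Hodge plane of `H³` of a smooth projective threefold is
realised by a one-dimensional abelian variety.** For a smooth projective threefold `Y`, a Hodge
model `A` and a finite set `s` of rational classes of `H³(Y(ℂ); ℂ)` whose span `W` is sub-Hodge, of
Hodge coniveau `≥ 1` and of dimension `2` (an "attractor plane" `V ≅ H¹(E)(−1)`), there are a
complex abelian variety `E` of dimension `1` (an elliptic curve with its group law; `E.X` smooth
projective of dimension `1`), a Hodge model `B` of `E.X` and a rational `ℂ`-linear map
`φ : H¹(E(ℂ); ℂ) → H³(Y(ℂ); ℂ)` of type `(1, 1)` with `φ(H¹(E(ℂ); ℂ)) = W` — the tree's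
`exists_curve_of_levelOne_threefold_span_of_finrank_eq_two` with the curve's abelian-variety
structure remembered (rank-two Riemann in the abelian form
`weightOne_polarizable_of_finrank_eq_two_abelian`, fed through the threaded reduction
`levelOne_subHodge_eq_range_of_curve_of_weightOneOfRank_mem`).
[cite: VoisinHodgeI2002, §7.2.2 and §7.3.1 Lemma 7.26] [cite: KerrPearlstein2016, Ch. 11 (Abdulali) §1 p. 288]
[cite: SilvermanAEC2009, III.3.6 and VI Prop. 3.6 (b)] -/
theorem exists_abelianCurve_of_levelOne_threefold_span_of_finrank_eq_two {Y : SchemeOver ℂ}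
    (hY : IsSmoothProjective 3 Y) (A : HodgeModel 3 Y) (s : Finset (complexBetti Y 3))
    (hs : ∀ c ∈ s, IsRationalClass c)
    (hs2 : Module.finrank ℂ (Submodule.span ℂ (↑s : Set (complexBetti Y 3))) = 2)
    (hsub : (Submodule.span ℂ (↑s : Set (complexBetti Y 3))).map (A.pullback 3).hom =
      ⨆ (p : ℕ) (q : ℕ) (_ : p + q = 3),
        (Submodule.span ℂ (↑s : Set (complexBetti Y 3))).map (A.pullback 3).hom ⊓ A.hodgePQ 3 p q)
    (hlev : (Submodule.span ℂ (↑s : Set (complexBetti Y 3))).map (A.pullback 3).hom ≤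
      ⨆ (p : ℕ) (q : ℕ) (_ : p + q = 3) (_ : 1 ≤ p) (_ : 1 ≤ q), A.hodgePQ 3 p q) :
    ∃ (E : AbelianVariety ℂ) (_ : E.dim = 1) (_ : IsSmoothProjective 1 E.X) (B : HodgeModel 1 E.X)
      (φ : complexBetti E.X 1 →ₗ[ℂ] complexBetti Y 3),
      (∀ c, IsRationalClass c → IsRationalClass (φ c)) ∧
      (∀ (p q : ℕ), p + q = 1 → ∀ c, B.pullback 1 c ∈ B.hodgePQ 1 p q →
        A.pullback 3 (φ c) ∈ A.hodgePQ 3 (p + 1) (q + 1)) ∧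
      LinearMap.range φ = Submodule.span ℂ (↑s : Set (complexBetti Y 3)) := by
  obtain ⟨C, ⟨E, hE, rfl⟩, hC, B, φ, hφ, hφH, hrange⟩ :=
    levelOne_subHodge_eq_range_of_curve_of_weightOneOfRank_mem
      (fun C ↦ ∃ E : AbelianVariety ℂ, E.dim = 1 ∧ E.X = C) hY A 1 _
      (isRationallySpanned_span fun c hc ↦ hs c hc) hsub hlev
      fun _ _ _ _ hV H hH heff ↦
        weightOne_polarizable_of_finrank_eq_two_abelian (hV.trans hs2) H hH heff
  exact ⟨E, hE, hC, B, φ, hφ, hφH, hrange⟩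

/-- **The registered sub-goal of the line** (lead c3, crux stmt-HodgeConjecture-3540;
`exists_abelianCurve_of_levelOne_threefold_span_of_finrank_eq_two` with all binders after the colon):
a rank-two rational level-one sub-Hodge plane of `H³` of a smooth projective threefold is
`φ(H¹(E(ℂ)))` for a one-dimensional complex abelian variety `E` and a rational type-`(1,1)` map `φ`.
[cite: VoisinHodgeI2002, §7.2.2 and §7.3.1 Lemma 7.26] [cite: KerrPearlstein2016, Ch. 11 (Abdulali) §1 p. 288] -/
theorem levelOnePlane_rankTwo_abelianCurve : ∀ ⦃Y : SchemeOver ℂ⦄ (_ : IsSmoothProjective 3 Y) (A : HodgeModel 3 Y) (s : Finset (complexBetti Y 3)), (∀ c ∈ s, IsRationalClass c) → Module.finrank ℂ (Submodule.span ℂ (↑s : Set (complexBetti Y 3))) = 2 → (Submodule.span ℂ (↑s : Set (complexBetti Y 3))).map (A.pullback 3).hom = (⨆ (p : ℕ) (q : ℕ) (_ : p + q = 3), (Submodule.span ℂ (↑s : Set (complexBetti Y 3))).map (A.pullback 3).hom ⊓ A.hodgePQ 3 p q) → (Submodule.span ℂ (↑s : Set (complexBetti Y 3))).map (A.pullback 3).hom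 ≤ (⨆ (p : ℕ) (q : ℕ) (_ : p + q = 3) (_ : 1 ≤ p) (_ : 1 ≤ q), A.hodgePQ 3 p q) → ∃ (E : AbelianVariety ℂ) (_ : E.dim = 1) (_ : IsSmoothProjective 1 E.X) (B : HodgeModel 1 E.X) (φ : complexBetti E.X 1 →ₗ[ℂ] complexBetti Y 3), (∀ c, IsRationalClass c → IsRationalClass (φ c)) ∧ (∀ (p q : ℕ), p + q = 1 → ∀ c, B.pullback 1 c ∈ B.hodgePQ 1 p q → A.pullback 3 (φ c) ∈ A.hodgePQ 3 (p + 1) (q + 1)) ∧ LinearMap.range φ = Submodule.span ℂ (↑s : Set (complexBetti Y 3)) :=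
  fun _ hY A s hs hs2 hsub hlev ↦
    exists_abelianCurve_of_levelOne_threefold_span_of_finrank_eq_two hY A s hs hs2 hsub hlev

end Summit.HodgeConjecture.HodgeConjecture.Theorems

end
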